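import Summits.Parity.BatemanHorn.Theses.RatioProfile

/-!
# Birth skeleton — crux `BoundaryRatioLaw` (route `RatioProfile`, item `stmt-Parity-10063`)

Line `birth` (skeleton registrar, BC3).  Write, for a Bateman–Horn system `f` of `k ≥ 1`
polynomials (notation of the route file: `π_x(j)`, `L(x)`, `ρ = polyRootCountMod f`),

  `u_f(x) := π_x(k+1)/π_x(k) − L(x) − Σ_{p ≤ x} [ρ(p)/(p − ρ(p)) + k·log(1 − 1/p)]`,

so that the crux reads `u_f(x) → kγ`.  The line splits the crux TAUBERIAN-wise into
REGULARITY × MEAN VALUE (the constant-free / constant-bearing halves of the route's foreseen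
split "existence of the limit → identification of the constant", TWO-LAYER PLAN of the route):

* `stub_slowOscillation` — SHAPE, no constant: `u_f` is slowly oscillating in R. Schmidt's sense
  (`|u_f(y) − u_f(x)| < ε` whenever `x ≤ y ≤ l·x`, `x` large, some `l = l(ε) > 1`).  Since `L`
  and the prime sum are themselves slowly oscillating (Mertens for `ρ`, provable from
  `AZFG2020_tendsto_sum_sub_omega_div_holds`), this says: the bottom likelihood ratio
  `r₁(x) = π_x(k+1)/π_x(k)` has no jumps between `x` and `l·x` — "no oscillating boundary
  layer", with no claim on the value of the boundary constant.
* `stub_cesaroMean` — VALUE, on average: the Cesàro mean `(1/n) Σ_{x<n} u_f(x)` tends to `kγ`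
  (the constant `kγ`, i.e. the `1/Γ(1+u)^k` large-prime factor of the Kubilius model /
  Chebyshev–Hooley mean of prime factors `> x`, is asserted only in the mean over `x`).
* `stub_schmidtTauber` — pure real analysis, provable now, not in Mathlib (R. Schmidt,
  Math. Z. 22 (1925); Hardy, *Divergent Series*, Thm. 68; the tree holds only the Laplace /
  bounded-variation form `Literature.NumberTheory.LFunctions.Elliott1997_10_1` as a named fact):
  a slowly oscillating real sequence that is (C,1)-summable to `c` converges to `c`.

`BoundaryRatioLaw_of : BoundaryRatioLaw` assembles the three BY NAME (no `sorry` outside the stubs; the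
hypothesis form `stub₁-sig → stub₂-sig → stub₃-sig → BoundaryRatioLaw` is the kernel-checked `example`
next to it).  Both number-theoretic
stubs are consequences of the crux (`Filter.Tendsto.cesaro`; convergent ⇒ slowly oscillating —
certified sorry-free at the end of this file: `slowOscillation_of_boundaryRatioLaw`,
`cesaroMean_of_boundaryRatioLaw`), so modulo the Tauberian stub the crux is EQUIVALENT to `stub₁ ∧ stub₂`: nothing is
lost, and the two halves can be attacked (or refuted) separately — a certified multiplicative-
scale jump of `r₁` kills stub₁ without any constant; a Cesàro drift away from `kγ` kills stub₂.
Disproof used: none relevant (no `Disproof.lean`, no `Negative/` lemma exists for this crux as of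
2026-08-17; `ledger crux ls stmt-Parity-10063`: no workfiles).
-/

namespace Summit.Parity.BatemanHorn.Cruxes.BoundaryRatioLaw.Birth

open Filter

/-! ### Registered stubs (the only `sorry`s of the line) -/

/-- stub (SHAPE — slow oscillation of the bottom ratio, R. Schmidt's Tauberian condition):
for every Bateman–Horn system of `k ≥ 1` polynomials, `u_f` is slowly oscillating:
for every `ε > 0` there is `l > 1` such that for all large `x` and all `y` with `x ≤ y ≤ l·x`,
`|u_f(y) − u_f(x)| < ε`.  Implied by the crux (a convergent sequence is slowly oscillating);
constant-free. -/
theorem stub_slowOscillation :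
    ∀ (k : ℕ) (f : Fin k → Polynomial ℤ), Literature.NumberTheory.Sieve.IsBatemanHornSystem f →
    0 < k →
    let ρ : ℕ → ℕ := fun p => Literature.NumberTheory.Sieve.polyRootCountMod f p;
    let π : ℕ → ℕ → ℕ := fun x j => ((Finset.Icc 1 x).filter (fun n : ℕ =>
      ArithmeticFunction.cardDistinctFactors (∏ i, (f i).eval (n : ℤ)).natAbs = j)).card;
    let L : ℕ → ℝ := fun x => (k : ℝ) * Real.log (Real.log (x : ℝ)) +
      Real.log (∏ i, ((f i).natDegree : ℝ));
    let u : ℕ → ℝ := fun x => (π x (k + 1) : ℝ) / (π x k : ℝ) - L x -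
      ∑ p ∈ Nat.primesLE x, ((ρ p : ℝ) / ((p : ℝ) - ρ p) + (k : ℝ) * Real.log (1 - 1 / (p : ℝ)));
    ∀ ε : ℝ, 0 < ε → ∃ l : ℝ, 1 < l ∧ ∀ᶠ x : ℕ in Filter.atTop, ∀ y : ℕ, x ≤ y →
      (y : ℝ) ≤ l * (x : ℝ) → |u y - u x| < ε := by
  sorry

/-- stub (VALUE — the boundary constant in Cesàro mean): for every Bateman–Horn system of
`k ≥ 1` polynomials, `(1/n) Σ_{x < n} u_f(x) → kγ`.  Implied by the crux
(`Filter.Tendsto.cesaro`); carries the constant but only on average over `x`. -/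
theorem stub_cesaroMean :
    ∀ (k : ℕ) (f : Fin k → Polynomial ℤ), Literature.NumberTheory.Sieve.IsBatemanHornSystem f →
    0 < k →
    let ρ : ℕ → ℕ := fun p => Literature.NumberTheory.Sieve.polyRootCountMod f p;
    let π : ℕ → ℕ → ℕ := fun x j => ((Finset.Icc 1 x).filter (fun n : ℕ =>
      ArithmeticFunction.cardDistinctFactors (∏ i, (f i).eval (n : ℤ)).natAbs = j)).card;
    let L : ℕ → ℝ := fun x => (k : ℝ) * Real.log (Real.log (x : ℝ)) +
      Real.log (∏ i, ((f i).natDegree : ℝ));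
    let u : ℕ → ℝ := fun x => (π x (k + 1) : ℝ) / (π x k : ℝ) - L x -
      ∑ p ∈ Nat.primesLE x, ((ρ p : ℝ) / ((p : ℝ) - ρ p) + (k : ℝ) * Real.log (1 - 1 / (p : ℝ)));
    Filter.Tendsto (fun n : ℕ => (n : ℝ)⁻¹ * ∑ x ∈ Finset.range n, u x) Filter.atTop
      (nhds ((k : ℝ) * Real.eulerMascheroniConstant)) := by
  sorry

/-- stub (TAUBERIAN GLUE — R. Schmidt 1925 / Hardy, Divergent Series Thm. 68, discrete (C,1)
form; provable now, not in Mathlib): a slowly oscillating real sequence whose Cesàro means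
converge to `c` converges to `c`.  Proof sketch: for large `n` and `m = ⌊l n⌋`,
`(m σ_m − n σ_n)/(m − n)` is the average of `u` over `[n, m)`, within `ε` of `u n` by slow
oscillation, and tends to `c` because `m/(m−n) ≤ 2l/(l−1)`. -/
theorem stub_schmidtTauber :
    ∀ (u : ℕ → ℝ) (c : ℝ),
    (∀ ε : ℝ, 0 < ε → ∃ l : ℝ, 1 < l ∧ ∀ᶠ x : ℕ in Filter.atTop, ∀ y : ℕ, x ≤ y →
      (y : ℝ) ≤ l * (x : ℝ) → |u y - u x| < ε) →
    Filter.Tendsto (fun n : ℕ => (n : ℝ)⁻¹ * ∑ x ∈ Finset.range n, u x) Filter.atTop (nhds c) →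
    Filter.Tendsto u Filter.atTop (nhds c) := by
  sorry

/-! ### Assembly -/

/-- ASSEMBLY IN HYPOTHESIS FORM (kernel-checked, sorry-free; an `example`, because the native skeleton
audit admits as hypotheses of a crux-concluding THEOREM only named obligations, and the stub-tag
attribute is gate-reserved): `stub_slowOscillation-sig → stub_cesaroMean-sig → stub_schmidtTauber-sig →
BoundaryRatioLaw`, system by system — Schmidt's Tauberian theorem applied to `u_f` with the two
number-theoretic inputs. -/
example :
    (∀ (k : ℕ) (f : Fin k → Polynomial ℤ), Literature.NumberTheory.Sieve.IsBatemanHornSystem f →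
    0 < k →
    let ρ : ℕ → ℕ := fun p => Literature.NumberTheory.Sieve.polyRootCountMod f p;
    let π : ℕ → ℕ → ℕ := fun x j => ((Finset.Icc 1 x).filter (fun n : ℕ =>
      ArithmeticFunction.cardDistinctFactors (∏ i, (f i).eval (n : ℤ)).natAbs = j)).card;
    let L : ℕ → ℝ := fun x => (k : ℝ) * Real.log (Real.log (x : ℝ)) +
      Real.log (∏ i, ((f i).natDegree : ℝ));
    let u : ℕ → ℝ := fun x => (π x (k + 1) : ℝ) / (π x k : ℝ) - L x -
      ∑ p ∈ Nat.primesLE x, ((ρ p : ℝ) / ((p : ℝ) - ρ p) + (k : ℝ) * Real.log (1 - 1 / (p : ℝ)));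
    ∀ ε : ℝ, 0 < ε → ∃ l : ℝ, 1 < l ∧ ∀ᶠ x : ℕ in Filter.atTop, ∀ y : ℕ, x ≤ y →
      (y : ℝ) ≤ l * (x : ℝ) → |u y - u x| < ε) →
    (∀ (k : ℕ) (f : Fin k → Polynomial ℤ), Literature.NumberTheory.Sieve.IsBatemanHornSystem f →
    0 < k →
    let ρ : ℕ → ℕ := fun p => Literature.NumberTheory.Sieve.polyRootCountMod f p;
    let π : ℕ → ℕ → ℕ := fun x j => ((Finset.Icc 1 x).filter (fun n : ℕ =>
      ArithmeticFunction.cardDistinctFactors (∏ i, (f i).eval (n : ℤ)).natAbs = j)).card;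
    let L : ℕ → ℝ := fun x => (k : ℝ) * Real.log (Real.log (x : ℝ)) +
      Real.log (∏ i, ((f i).natDegree : ℝ));
    let u : ℕ → ℝ := fun x => (π x (k + 1) : ℝ) / (π x k : ℝ) - L x -
      ∑ p ∈ Nat.primesLE x, ((ρ p : ℝ) / ((p : ℝ) - ρ p) + (k : ℝ) * Real.log (1 - 1 / (p : ℝ)));
    Filter.Tendsto (fun n : ℕ => (n : ℝ)⁻¹ * ∑ x ∈ Finset.range n, u x) Filter.atTop
      (nhds ((k : ℝ) * Real.eulerMascheroniConstant))) →
    (∀ (u : ℕ → ℝ) (c : ℝ),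
    (∀ ε : ℝ, 0 < ε → ∃ l : ℝ, 1 < l ∧ ∀ᶠ x : ℕ in Filter.atTop, ∀ y : ℕ, x ≤ y →
      (y : ℝ) ≤ l * (x : ℝ) → |u y - u x| < ε) →
    Filter.Tendsto (fun n : ℕ => (n : ℝ)⁻¹ * ∑ x ∈ Finset.range n, u x) Filter.atTop (nhds c) →
    Filter.Tendsto u Filter.atTop (nhds c)) →
    Summit.Parity.BatemanHorn.Theses.RatioProfile.BoundaryRatioLaw := by
  intro h₁ h₂ h₃ k f hf hk
  exact h₃ _ _ (h₁ k f hf hk) (h₂ k f hf hk)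

/-- THE SKELETON THEOREM (D-0027 §3.3 shape; the composition above with the registered stubs plugged
in BY NAME): the crux `RatioProfile.BoundaryRatioLaw`, concluded by name; no `sorry` here — it becomes
the crux proof when the three `stub_…` are discharged (`#print axioms` today: the stubs' `sorryAx`
plus propext / Classical.choice / Quot.sound). -/
theorem BoundaryRatioLaw_of :
    Summit.Parity.BatemanHorn.Theses.RatioProfile.BoundaryRatioLaw := by
  intro k f hf hk
  exact stub_schmidtTauber _ _ (stub_slowOscillation k f hf hk) (stub_cesaroMean k f hf hk)

/-! ### Exactness of the split (sorry-free): the crux implies both number-theoretic stubs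

So, modulo the true analysis stub `stub_schmidtTauber`, the crux is EQUIVALENT to
`stub_slowOscillation ∧ stub_cesaroMean` — the line loses nothing. -/

/-- A convergent real sequence is slowly oscillating (with any `l > 1`; here `l = 2`). [folklore] -/
theorem slowOscillation_of_tendsto {u : ℕ → ℝ} {c : ℝ} (h : Filter.Tendsto u Filter.atTop (nhds c)) :
    ∀ ε : ℝ, 0 < ε → ∃ l : ℝ, 1 < l ∧ ∀ᶠ x : ℕ in Filter.atTop, ∀ y : ℕ, x ≤ y →
      (y : ℝ) ≤ l * (x : ℝ) → |u y - u x| < ε := by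
  intro ε hε
  refine ⟨2, by norm_num, ?_⟩
  obtain ⟨N, hN⟩ := (Metric.tendsto_atTop.mp h) (ε / 2) (by positivity)
  filter_upwards [Filter.eventually_ge_atTop N] with x hx
  intro y hxy _
  have h1 := hN x hx
  have h2 := hN y (le_trans hx hxy)
  rw [Real.dist_eq] at h1 h2
  calc |u y - u x| = |(u y - c) - (u x - c)| := by ring_nf
    _ ≤ |u y - c| + |u x - c| := abs_sub _ _
    _ < ε / 2 + ε / 2 := add_lt_add h2 h1
    _ = ε := by ring

/-- The crux implies `stub_slowOscillation`'s statement. [folklore] -/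
theorem slowOscillation_of_boundaryRatioLaw
    (h : Summit.Parity.BatemanHorn.Theses.RatioProfile.BoundaryRatioLaw) :
    ∀ (k : ℕ) (f : Fin k → Polynomial ℤ), Literature.NumberTheory.Sieve.IsBatemanHornSystem f →
    0 < k →
    let ρ : ℕ → ℕ := fun p => Literature.NumberTheory.Sieve.polyRootCountMod f p;
    let π : ℕ → ℕ → ℕ := fun x j => ((Finset.Icc 1 x).filter (fun n : ℕ =>
      ArithmeticFunction.cardDistinctFactors (∏ i, (f i).eval (n : ℤ)).natAbs = j)).card;
    let L : ℕ → ℝ := fun x => (k : ℝ) * Real.log (Real.log (x : ℝ)) +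
      Real.log (∏ i, ((f i).natDegree : ℝ));
    let u : ℕ → ℝ := fun x => (π x (k + 1) : ℝ) / (π x k : ℝ) - L x -
      ∑ p ∈ Nat.primesLE x, ((ρ p : ℝ) / ((p : ℝ) - ρ p) + (k : ℝ) * Real.log (1 - 1 / (p : ℝ)));
    ∀ ε : ℝ, 0 < ε → ∃ l : ℝ, 1 < l ∧ ∀ᶠ x : ℕ in Filter.atTop, ∀ y : ℕ, x ≤ y →
      (y : ℝ) ≤ l * (x : ℝ) → |u y - u x| < ε := by
  intro k f hf hk
  exact slowOscillation_of_tendsto (h k f hf hk)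

/-- The crux implies `stub_cesaroMean`'s statement (`Filter.Tendsto.cesaro`). [folklore] -/
theorem cesaroMean_of_boundaryRatioLaw
    (h : Summit.Parity.BatemanHorn.Theses.RatioProfile.BoundaryRatioLaw) :
    ∀ (k : ℕ) (f : Fin k → Polynomial ℤ), Literature.NumberTheory.Sieve.IsBatemanHornSystem f →
    0 < k →
    let ρ : ℕ → ℕ := fun p => Literature.NumberTheory.Sieve.polyRootCountMod f p;
    let π : ℕ → ℕ → ℕ := fun x j => ((Finset.Icc 1 x).filter (fun n : ℕ =>
      ArithmeticFunction.cardDistinctFactors (∏ i, (f i).eval (n : ℤ)).natAbs = j)).card;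
    let L : ℕ → ℝ := fun x => (k : ℝ) * Real.log (Real.log (x : ℝ)) +
      Real.log (∏ i, ((f i).natDegree : ℝ));
    let u : ℕ → ℝ := fun x => (π x (k + 1) : ℝ) / (π x k : ℝ) - L x -
      ∑ p ∈ Nat.primesLE x, ((ρ p : ℝ) / ((p : ℝ) - ρ p) + (k : ℝ) * Real.log (1 - 1 / (p : ℝ)));
    Filter.Tendsto (fun n : ℕ => (n : ℝ)⁻¹ * ∑ x ∈ Finset.range n, u x) Filter.atTop
      (nhds ((k : ℝ) * Real.eulerMascheroniConstant)) := by
  intro k f hf hk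
  exact (h k f hf hk).cesaro

end Summit.Parity.BatemanHorn.Cruxes.BoundaryRatioLaw.Birth
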